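import Literature.AlgebraicGeometry.AbelianSchemes.LevelStructureSpread
import Literature.AlgebraicGeometry.AbelianSchemes.LevelStructureTransportIso
import Literature.AlgebraicGeometry.AbelianSchemes.PolarizedAbelianSchemeWithLevelBaseChangeCancel
import Literature.AlgebraicGeometry.AbelianSchemes.PolarizedAbelianSchemeWithLevelBaseChangeUnique
import Literature.AlgebraicGeometry.AbelianSchemes.AbelianSchemeOverFibreIdentity
import Literature.AlgebraicGeometry.ModuliOfAbelianVarieties.SiegelAdmissibleOfIsoId
import Literature.AlgebraicGeometry.Limits.LocalizationRelativeGroupSpread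
import Literature.AlgebraicGeometry.Limits.LocalizationRelativeSmoothSpread
import Literature.AlgebraicGeometry.Limits.LocalizationTwoOpensGlue
import HarnessLib

/-!
# SPREAD SEQUEL (s3): the SP1 → SP2 junction — a level structure on the GENERIC BASE CHANGE OF A STAGE abelian scheme
# spreads to a finer stage (MFK Prop. 7.3 (IV) docked on the relative stages `P ⊗ D(s) → P ⊗ D(t)`)

Layer `Literature/AlgebraicGeometry/AbelianSchemes`, namespace `Literature.AlgebraicGeometry.AbelianSchemes.AbelianSchemeOver` (§2) and
`Literature.AlgebraicGeometry.Limits.LocApprox` (§1).  THEOREMS ONLY (no definition, no named fact, no instance, no notation, no `sorry`).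
Cell `hodgecm-mathlib` (D-0151), FLOOR 0, P6 «MOD programme» (crux hLiu418 = stmt-HodgeConjecture-24832), SPREAD door, deal «SPREAD SEQUELS
(s1)–(s3)» (LEAD F0P6-plan (g2) 2026-09-01 21:21:21Z ∕ 21:22:30Z; B-p18 (g37)), item (s3) «the SP1→SP2 junction rider»; consumed by the
`stub_RGD` assembly (GEN heir A-p18) next to ★ (s1) `AbelianSchemeOverSpreadStageStructure.exists_stage_ringAction` (same currency:
`genOver ∕ stageOver ∕ relLeg` of ★ `Limits/LocalizationRelativeGroupSpread`).  HC_CM is proved only modulo the printed citations until rung 0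
closes; this file is generic and changes no count.

THE JUNCTION.  ★ SP1 (`AbelianSchemeOverSpreadStage.exists_stage_of_generic_of_isOfRelDim`) hands an abelian scheme `𝒜ₜ` over a STAGE BASE
`P ⊗ D(t)` whose base change along the cone leg `P ⊗ Spec B → P ⊗ D(t)` (★ `genOver`) is the given generic one; ★ SP2
(`LevelStructure.exists_stage_of_generic`, MFK Prop. 7.3 (IV)) spreads a level structure from the generic fibre `P′ ⊗ Spec B` of an abelian
scheme over a WHOLE base `P′`.  Docking SP2 at `P′ := P ⊗ D(t)`: (§1) the generic point of `P` IS the generic point of the stage base,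
`j : P ⊗ Spec B ≅ (P ⊗ D(t)) ⊗ Spec B` with `j ≫ pr₁ = P ◁ π_t` (morphisms over `Spec A` into the open `D(t)` are unique); (§2) the level
structure moves along `j` (★ `LevelStructure.baseChange` + the comparison isomorphism of two base changes along the same map, ★
`IsBaseChangeVia.exists_isBaseChangeVia_id` ∕ `exists_iso_of_isBaseChangeVia_id` ∕ `LevelStructure.exists_comp_of_iso`), SP2 runs over `P′`, and its
output over `(P ⊗ D(t)) ⊗ D(t′)` is re-indexed to a common finer stage `P ⊗ D(s)` (`s ≤ t, t′`, ★ `exists_hom₂`) along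
`k : P ⊗ D(s) → (P ⊗ D(t)) ⊗ D(t′)` (`k ≫ pr₁ = P ◁ D(s ≤ t)`), the pull-back relations being composed and cancelled by ★
`LevelStructure.IsBaseChangeVia.trans` ∕ `LevelStructure.isBaseChangeVia_of_comp`.  OUTPUT: a level structure `ψ` on the chosen restriction
`𝒜ₜ ×_{P⊗D(t)} (P ⊗ D(s))` (★ `baseChange (stageOver σ).hom`) of which the given one is the base change along the relative leg
(★ `relLeg`), through a total-space map `G` over `𝒜ₜ`.

## References
* [MumfordFogartyKirwan1994] D. Mumford, J. Fogarty, F. Kirwan, *Geometric Invariant Theory*, 3rd ed. (1994), Ch. 7 §2 Def. 7.1–7.3 (p. 129),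
  Prop. 7.3 step (IV) (pp. 133–134).
* [EGAIV3] A. Grothendieck, J. Dieudonné, *EGA IV₃* (1966), Thm. 8.8.2, 8.10.5.
* [GortzWedhorn2020] U. Görtz, T. Wedhorn, *Algebraic Geometry I*, 2nd ed. (2020), Prop. 4.16 (p. 101), §(4.7), §(10.13), Thm. 10.57 ∕ Cor. 10.64.
* [StacksProject] The Stacks Project, Tags 01ZC, 01Z3, 01YT.
-/

set_option autoImplicit false

noncomputable section

universe u

open CategoryTheory CategoryTheory.Limits AlgebraicGeometry MonoidalCategory CartesianMonoidalCategory
open scoped MonObj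

/-! ## §1 The generic point of `P` is the generic point of the stage base `P ⊗ D(t)` -/

namespace Literature.AlgebraicGeometry.Limits

namespace LocApprox

open Literature.AlgebraicGeometry.Motives (SchemeOver specOver)

variable {A : Type u} [CommRing A] {S : Submonoid A} (B : Type u) [CommRing B] [Algebra A B] [IsLocalization S B]
  (P : SchemeOver A)

/-- **`P ⊗ Spec B ≅ (P ⊗ D(t)) ⊗ Spec B` over the stage base**: `j := (P ◁ π_t, pr₂)` with inverse `(pr₁ ≫ pr₁, pr₂)`; `j ≫ pr₁ = P ◁ π_t`.
The identity `(pr₁ ≫ pr₁, pr₂) ≫ (P ◁ π_t) = pr₁` holds because its two components agree: on `P` trivially, on `D(t)` because morphisms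
over `Spec A` into the open subscheme `D(t) = Spec A[1∕t]` are unique (★ `hom_eq_of_mono_hom`). [cite: StacksProject, Tag 01YT]
[cite: GortzWedhorn2020, §(10.13) (pp. 261–262)] -/
theorem exists_iso_tensor_leg (t : Idx S) :
    ∃ j : P ⊗ specOver A B ≅ (P ⊗ (baseDiagram S).obj t) ⊗ specOver A B, j.hom ≫ fst _ _ = P ◁ leg S B t := by
  haveI : Mono ((baseDiagram S).obj t).hom := inferInstance
  have hinv : lift (fst (P ⊗ (baseDiagram S).obj t) (specOver A B) ≫ fst P ((baseDiagram S).obj t))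
      (snd (P ⊗ (baseDiagram S).obj t) (specOver A B)) ≫ P ◁ leg S B t = fst _ _ := by
    apply CartesianMonoidalCategory.hom_ext
    · rw [Category.assoc, whiskerLeft_fst, lift_fst]
    · exact hom_eq_of_mono_hom ((baseDiagram S).obj t) _ _
  refine ⟨⟨lift (P ◁ leg S B t) (snd _ _), lift (fst _ _ ≫ fst _ _) (snd _ _), ?_, ?_⟩, lift_fst _ _⟩
  · apply CartesianMonoidalCategory.hom_ext
    · rw [Category.assoc, lift_fst, ← Category.assoc, lift_fst, whiskerLeft_fst, Category.id_comp]
    · rw [Category.assoc, lift_snd, lift_snd, Category.id_comp]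
  · apply CartesianMonoidalCategory.hom_ext
    · rw [Category.assoc, lift_fst, hinv, Category.id_comp]
    · rw [Category.assoc, lift_snd, lift_snd, Category.id_comp]

/-- **The comparison `k : P ⊗ D(s) → (P ⊗ D(t)) ⊗ D(t′)` of a common finer stage** (`σ : s ⟶ t`, `σ′ : s ⟶ t′`): `k := (P ◁ D(σ), pr₂ ≫ D(σ′))`,
`k ≫ pr₁ = P ◁ D(σ)`, and the generic legs match: `(P ◁ π_s) ≫ k = j ≫ ((P ⊗ D(t)) ◁ π_{t′})` for any `j` with `j ≫ pr₁ = P ◁ π_t` (components: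
`π_s ≫ D(σ) = π_t` on the first factor, uniqueness of morphisms into `D(t′)` on the second). [cite: StacksProject, Tag 01YT]
[cite: GortzWedhorn2020, §(10.13) (pp. 261–262)] -/
theorem exists_stageComparison {s t t' : Idx S} (σ : s ⟶ t) (σ' : s ⟶ t')
    (j : P ⊗ specOver A B ⟶ (P ⊗ (baseDiagram S).obj t) ⊗ specOver A B) (hj : j ≫ fst _ _ = P ◁ leg S B t) :
    ∃ k : P ⊗ (baseDiagram S).obj s ⟶ (P ⊗ (baseDiagram S).obj t) ⊗ (baseDiagram S).obj t',
      k ≫ fst _ _ = P ◁ (baseDiagram S).map σ ∧ (P ◁ leg S B s) ≫ k = j ≫ (P ⊗ (baseDiagram S).obj t) ◁ leg S B t' := by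
  haveI : Mono ((baseDiagram S).obj t').hom := inferInstance
  refine ⟨lift (P ◁ (baseDiagram S).map σ) (snd _ _ ≫ (baseDiagram S).map σ'), lift_fst _ _, ?_⟩
  apply CartesianMonoidalCategory.hom_ext
  · rw [Category.assoc, Category.assoc, lift_fst, whiskerLeft_fst, ← MonoidalCategory.whiskerLeft_comp, leg_comp_map, hj]
  · exact hom_eq_of_mono_hom ((baseDiagram S).obj t') _ _

end LocApprox

end Literature.AlgebraicGeometry.Limits

/-! ## §2 The junction: a level structure on `𝒜ₜ ×_{P⊗D(t)} (P ⊗ Spec B)` spreads to `𝒜ₜ ×_{P⊗D(t)} (P ⊗ D(s))` -/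

namespace Literature.AlgebraicGeometry.AbelianSchemes

namespace AbelianSchemeOver

open Literature.AlgebraicGeometry.Limits Literature.AlgebraicGeometry.Limits.LocApprox
open Literature.AlgebraicGeometry.Motives (SchemeOver specOver)

variable {A : Type u} [CommRing A] {S : Submonoid A} (B : Type u) [CommRing B] [Algebra A B] [IsLocalization S B]
  {P : SchemeOver A} [QuasiCompact P.hom] [QuasiSeparated P.hom] [LocallyOfFinitePresentation P.hom]

/-- **SPREAD OF A LEVEL STRUCTURE FROM THE GENERIC BASE CHANGE OF A STAGE ABELIAN SCHEME** (MFK Prop. 7.3 (IV) at the SP1 output).  `P → Spec A`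
quasi-compact, quasi-separated, locally of finite presentation, `B = A_S`, `N ≠ 0` invertible in `B`; `𝒜ₜ` an abelian scheme of relative
dimension `g` over the stage base `P ⊗ D(t)`, `φ` a level-`N` structure on its base change along the cone leg `P ⊗ Spec B → P ⊗ D(t)`
(★ `genOver`).  THEN for some finer stage `σ : s ⟶ t` there are a level-`N` structure `ψ` on the restriction `𝒜ₜ ×_{P⊗D(t)} (P ⊗ D(s))`
(★ `baseChange (stageOver σ).hom`) and a map `G` of total spaces OVER `𝒜ₜ` (`G ≫ pr = pr`) exhibiting `φ` as the base change of `ψ` along the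
relative leg `P ⊗ Spec B → P ⊗ D(s)` (★ `relLeg`; ★ `LevelStructure.IsBaseChangeVia`: cartesian square of group schemes + sections).
Proof: §1 + ★ SP2 over the base `P ⊗ D(t)` + re-indexing to a common finer stage, the pull-back relations composed ∕ cancelled ∕ compared
by the ★ `IsBaseChangeVia` calculus. [cite: MumfordFogartyKirwan1994, Ch. 7 §2 Definitions 7.1–7.3 (p. 129), Proposition 7.3 step (IV) (pp. 133–134)]
[cite: EGAIV3, Thm. 8.8.2 and Thm. 8.10.5] [cite: GortzWedhorn2020, Prop. 4.16 (p. 101) and Thm. 10.57 ∕ Cor. 10.64 (pp. 264–267)] -/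
theorem LevelStructure.exists_stage_of_generic_overStage {t : Idx S} (𝒜ₜ : AbelianSchemeOver (P ⊗ (baseDiagram S).obj t).left)
    {g N : ℕ} [NeZero N] (hg : 𝒜ₜ.IsOfRelDim g) (hN : IsUnit ((N : ℕ) : B))
    (φ : LevelStructure g N (𝒜ₜ.baseChange (genOver S B P t).hom)) :
    ∃ (s : Idx S) (σ : s ⟶ t) (ψ : LevelStructure g N (𝒜ₜ.baseChange (stageOver S P σ).hom))
      (G : (𝒜ₜ.baseChange (genOver S B P t).hom).X.left ⟶ (𝒜ₜ.baseChange (stageOver S P σ).hom).X.left),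
      G ≫ pullback.fst 𝒜ₜ.X.hom (stageOver S P σ).hom = pullback.fst 𝒜ₜ.X.hom (genOver S B P t).hom ∧
      φ.IsBaseChangeVia ψ (relLeg S B P σ).left G := by
  classical
  -- the stage base `P' := P ⊗ D(t)` over `A` is again quasi-compact and quasi-separated (and of finite presentation, ★ instance)
  haveI : QuasiCompact (P ⊗ (baseDiagram S).obj t).hom := quasiCompact_tensorObj_baseDiagram_hom P t
  haveI : QuasiSeparated (P ⊗ (baseDiagram S).obj t).hom := by rw [Over.tensorObj_hom]; infer_instance
  -- (1) the generic point of `P` as the generic point of `P'`: `j ≫ pr₁ = P ◁ π_t`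
  obtain ⟨j, hj⟩ := exists_iso_tensor_leg (S := S) B P t
  have hj' : j.inv ≫ P ◁ leg S B t = fst _ _ := by rw [← hj, Iso.inv_hom_id_assoc]
  have hcomp : j.inv.left ≫ (genOver S B P t).hom = (fst (P ⊗ (baseDiagram S).obj t) (specOver A B)).left := by
    change j.inv.left ≫ (P ◁ leg S B t).left = _
    rw [← Over.comp_left, hj']
  -- (2) move `φ` onto `𝒜ₜ ×_{P'} (P' ⊗ Spec B)`: pull back along `j⁻¹`, then compare two base changes of `𝒜ₜ` along `pr₁`
  have h₁ := 𝒜ₜ.baseChange_isBaseChangeVia (genOver S B P t).hom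
  have h₂ := 𝒜ₜ.baseChange_isBaseChangeVia (fst (P ⊗ (baseDiagram S).obj t) (specOver A B)).left
  have hφ₃ := φ.baseChange_isBaseChangeVia j.inv.left
  have h₃₁ := hφ₃.1.trans h₁
  rw [hcomp] at h₃₁
  obtain ⟨H, hHiso, hHfst, hH⟩ := h₂.exists_isBaseChangeVia_id h₃₁
  haveI := hHiso
  obtain ⟨e, he, hemon⟩ := exists_iso_of_isBaseChangeVia_id hH
  haveI := hemon
  obtain ⟨φ', hφ'⟩ := LevelStructure.exists_comp_of_iso e (φ.baseChange j.inv.left)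
  have hφ₃' : (φ.baseChange j.inv.left).IsBaseChangeVia φ' (𝟙 _) e.hom.left :=
    levelStructure_isBaseChangeVia_id_of_isMonHom _ _ e.hom (fun i => (hφ' i).symm)
  -- `φ` is the base change of `φ ×_{j⁻¹}` along `j` (cancellation against the identity relation)
  have hrefl : φ.IsBaseChangeVia φ (j.hom ≫ j.inv).left (𝟙 _) := by
    rw [Iso.hom_inv_id]
    exact LevelStructure.IsBaseChangeVia.refl φ
  obtain ⟨m₀, hm₀G, hm₀π⟩ := IsBaseChangeVia.exists_comp_eq_of_comp hrefl.1 hφ₃.1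
  have hφφ₃ : φ.IsBaseChangeVia (φ.baseChange j.inv.left) j.hom.left m₀ :=
    LevelStructure.isBaseChangeVia_of_comp hrefl hφ₃ m₀ hm₀G hm₀π
  have hφφ' := hφφ₃.trans hφ₃'
  rw [Category.comp_id] at hφφ'
  -- (3) SP2 over the base `P'`
  obtain ⟨t', 𝒞, Hc, ψ₀, G', h𝒞, hG'H, hφ'ψ₀⟩ := LevelStructure.exists_stage_of_generic (S := S) B 𝒜ₜ hg hN φ'
  -- (4) a common finer stage `s ≤ t, t'`, the comparison `k`, and the matching of the generic legs
  obtain ⟨s, ⟨σ⟩, ⟨σ'⟩⟩ := exists_hom₂ S t t'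
  obtain ⟨k, hk, hleg⟩ := exists_stageComparison (S := S) B P σ σ' j.hom hj
  have hkleft : k.left ≫ (fst (P ⊗ (baseDiagram S).obj t) ((baseDiagram S).obj t')).left = (stageOver S P σ).hom := by
    change _ = (P ◁ (baseDiagram S).map σ).left
    rw [← Over.comp_left, hk]
  -- (typed over the base `(genOver t).left` of `φ`, the presentation the composed relations below carry)
  have hlegleft : ((relLeg S B P σ).left ≫ k.left : (genOver S B P t).left ⟶ _) =
      (j.hom.left ≫ ((P ⊗ (baseDiagram S).obj t) ◁ (baseCone S B).π.app t').left : (genOver S B P t).left ⟶ _) := by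
    have e₁ := congrArg CommaMorphism.left hleg
    simp only [Over.comp_left] at e₁
    exact e₁
  -- the restriction `𝒞 ×_{P'⊗D(t')} (P ⊗ D(s))` versus the chosen `𝒜ₜ ×_{P⊗D(t)} (P ⊗ D(s))`: two base changes of `𝒜ₜ` along `P ◁ D(σ)`
  have h₅ := 𝒞.baseChange_isBaseChangeVia k.left
  have hψ₅ := ψ₀.baseChange_isBaseChangeVia k.left
  have h₅c := h₅.trans h𝒞
  rw [hkleft] at h₅c
  have h₆ := 𝒜ₜ.baseChange_isBaseChangeVia (stageOver S P σ).hom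
  obtain ⟨H₂, hH₂iso, hH₂fst, hH₂⟩ := h₆.exists_isBaseChangeVia_id h₅c
  haveI := hH₂iso
  obtain ⟨e₂, he₂, he₂mon⟩ := exists_iso_of_isBaseChangeVia_id hH₂
  haveI := he₂mon
  obtain ⟨ψ, hψ⟩ := LevelStructure.exists_comp_of_iso e₂ (ψ₀.baseChange k.left)
  have hψ₅ψ : (ψ₀.baseChange k.left).IsBaseChangeVia ψ (𝟙 _) e₂.hom.left :=
    levelStructure_isBaseChangeVia_id_of_isMonHom _ _ e₂.hom (fun i => (hψ i).symm)
  -- generic side: `φ → ψ₀` along `(P ◁ π_s) ≫ k`, cancelled against `ψ₀ ×_k → ψ₀`, then moved along `e₂`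
  have hφψ₀ := hφφ'.trans hφ'ψ₀
  rw [← hlegleft] at hφψ₀
  obtain ⟨m₅, hm₅G, hm₅π⟩ := IsBaseChangeVia.exists_comp_eq_of_comp hφψ₀.1 hψ₅.1
  have hφψ₅ : φ.IsBaseChangeVia (ψ₀.baseChange k.left) (relLeg S B P σ).left m₅ :=
    LevelStructure.isBaseChangeVia_of_comp hφψ₀ hψ₅ m₅ hm₅G hm₅π
  have hfinal := hφψ₅.trans hψ₅ψ
  -- (`erw`: the bases `(stageOver σ).left` and `(P ⊗ D(s)).left` of the two relations agree only up to unfolding `Over.mk`)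
  erw [Category.comp_id] at hfinal
  refine ⟨s, σ, ψ, m₅ ≫ e₂.hom.left, ?_, hfinal⟩
  -- `G` lies over `𝒜ₜ`
  rw [he₂, Category.assoc, hH₂fst, ← Category.assoc, hm₅G, Category.assoc, hG'H, Category.assoc, he, hHfst,
    ← Category.assoc, hm₀G, Category.id_comp]

end AbelianSchemeOver

end Literature.AlgebraicGeometry.AbelianSchemes

end
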